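import Literature.MathematicalPhysics.StatisticalMechanics.BarlowCoordination

/-!
# Deck transformations of `ℤ³`-indexed bond coverings — abstract part

Helper file A of the stub `stub_deckTransitive` of the line `develop-the-model-growth-descent`
(crux `ShellsToBarlowChart`, stmt-AtomisticToContinuum-9227): the choice-free "commuting lifted
moves" construction of deck transformations, for an abstract point map `Φ : ℤ³ → α` and contact
relation `adj` on `ℤ³` that is star-injective (`hinj`), star-surjective over equal points
(`hsurj`) and link-faithful (`hlink`), whose six unit steps `U` are contacts (`hunit`), whose
three commuting unit squares have a contact diagonal (`h12, h13, h23`), and all of whose contacts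
are words of length `≤ 2` in the unit steps (`hgen`):

* `deck_comm_pt`, `deck_triangle_pt` — commuting squares with a contact diagonal have commuting
  lifts; contact triangles lift to contact triangles;
* `deck_exists_state` — three pairwise commuting invertible lifted steps integrate (as `zpow`s in
  `Equiv.Perm`) to a `ℤ³`-family of states;
* `deck_exists_map`, `deck_exists` — any two indices over the same point are exchanged by a
  fixed-point-free `Φ`-compatible bijection of `ℤ³` preserving and reflecting contacts;
* `deck_unique` — uniqueness of such lifts.

The specialisation to the model `barlowStacking 1 √(2/3) s` is the file `…DeckTransitive.lean`.

The set of unit steps is a parameter `U` fixed by the hypothesis `hU` (no notation is declared).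
-/

namespace Summit.AtomisticToContinuum.Crystallization.Theorems.PalmUnimodularRigidityShellsToBarlowChart

/-! ## Pointwise lifting lemmas (any index type) -/

/-- **Commuting lifted moves** (pointwise form): for a commuting square `t → x → z`, `t → y → z`
of contacts one of whose diagonals is a contact, the two lifts of `z` through the lifts `a`
(of `x`) and `c` (of `y`) over a sheet `t'` of `t` coincide. [folklore] -/
theorem deck_comm_pt {T α : Type*} {Φ : T → α} {adj : T → T → Prop}
    (hinj : ∀ r u₁ u₂, adj r u₁ → adj r u₂ → Φ u₁ = Φ u₂ → u₁ = u₂)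
    (hsurj : ∀ r r' u, Φ r = Φ r' → adj r u → ∃ u', adj r' u' ∧ Φ u' = Φ u)
    (hlink : ∀ r r' u₁ u₂ u₁' u₂', adj r u₁ → adj r u₂ → adj r' u₁' → adj r' u₂' →
      Φ u₁' = Φ u₁ → Φ u₂' = Φ u₂ → adj u₁ u₂ → adj u₁' u₂')
    {t t' x y z a b c d : T} (h₀ : Φ t = Φ t') (htx : adj t x) (hty : adj t y) (hxz : adj x z)
    (hyz : adj y z) (hdiag : adj t z ∨ adj x y)
    (ha : adj t' a) (hΦa : Φ a = Φ x) (hb : adj a b) (hΦb : Φ b = Φ z)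
    (hc : adj t' c) (hΦc : Φ c = Φ y) (hd : adj c d) (hΦd : Φ d = Φ z) : b = d := by
  rcases hdiag with htz | hxy
  · obtain ⟨e, he, hΦe⟩ := hsurj t t' z h₀ htz
    have hae : adj a e := hlink t t' x z a e htx htz ha he hΦa hΦe hxz
    have hce : adj c e := hlink t t' y z c e hty htz hc he hΦc hΦe hyz
    rw [hinj a b e hb hae (hΦb.trans hΦe.symm), hinj c d e hd hce (hΦd.trans hΦe.symm)]
  · have hac : adj a c := hlink t t' x y a c htx hty ha hc hΦa hΦc hxy
    have hcb : adj c b := hlink x a y z c b hxy hxz hac hb hΦc hΦb hyz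
    exact hinj c b d hcb hd (hΦb.trans hΦd.symm)

/-- **Triangle lifting** (pointwise form; the registered anchor of this helper file, stated with
all hypotheses after the colon): for a star-injective (first hypothesis), star-surjective (second)
and link-faithful (third) point map `Φ` on a contact relation `adj`, lifting the two sides
`t → y → z` of a contact triangle over a sheet `t'` of `t` ends at a contact of `t'`. [folklore] -/
theorem deck_triangle_pt : ∀ {T α : Type*} {Φ : T → α} {adj : T → T → Prop}, (∀ r u₁ u₂, adj r u₁ → adj r u₂ → Φ u₁ = Φ u₂ → u₁ = u₂) → (∀ r r' u, Φ r = Φ r' → adj r u → ∃ u', adj r' u' ∧ Φ u' = Φ u) → (∀ r r' u₁ u₂ u₁' u₂', adj r u₁ → adj r u₂ → adj r' u₁' → adj r' u₂' → Φ u₁' = Φ u₁ → Φ u₂' = Φ u₂ → adj u₁ u₂ → adj u₁' u₂') → ∀ {t t' y z c d : T}, Φ t = Φ t' → adj t y → adj t z → adj y z → adj t' c → Φ c = Φ y → adj c d → Φ d = Φ z → adj t' d := by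
  intro T α Φ adj hinj hsurj hlink t t' y z c d h₀ hty htz hyz hc hΦc hd hΦd
  obtain ⟨e, he, hΦe⟩ := hsurj t t' z h₀ htz
  have hce : adj c e := hlink t t' y z c e hty htz hc he hΦc hΦe hyz
  rwa [hinj c d e hd hce (hΦd.trans hΦe.symm)]

/-! ## Unique lifting along the commuting unit steps of `ℤ³` -/

section Steps

variable {U : Finset (ℤ × ℤ × ℤ)}
  (hU : U = {(1, 0, 0), (-1, 0, 0), (0, 1, 0), (0, -1, 0), (0, 0, 1), (0, 0, -1)})
include hU

/-- `U` is closed under negation. [folklore] -/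
theorem deck_neg_mem {v : ℤ × ℤ × ℤ} (hv : v ∈ U) : -v ∈ U := by
  rw [hU] at hv ⊢
  simp only [Finset.mem_insert, Finset.mem_singleton] at hv ⊢
  rcases hv with rfl | rfl | rfl | rfl | rfl | rfl <;> simp

/-- Induction on `ℤ³` along the six unit steps. [folklore] -/
theorem deck_induction {C : ℤ × ℤ × ℤ → Prop} (t₀ : ℤ × ℤ × ℤ) (h0 : C t₀)
    (hstep : ∀ t, ∀ v ∈ U, C t → C (t + v)) (t : ℤ × ℤ × ℤ) : C t := by
  have hax : ∀ u, C u → ∀ a ∈ U, ∀ n : ℤ, C (u + n • a) := by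
    intro u hu a ha n
    induction n with
    | zero => simpa using hu
    | succ n ih =>
      have := hstep _ a ha ih
      rwa [add_assoc, ← add_one_zsmul] at this
    | pred n ih =>
      have := hstep _ (-a) (deck_neg_mem hU ha) ih
      rwa [add_assoc, ← sub_one_zsmul] at this
  have h1 := hax t₀ h0 (1, 0, 0) (by rw [hU]; simp) (t.1 - t₀.1)
  have h2 := hax _ h1 (0, 1, 0) (by rw [hU]; simp) (t.2.1 - t₀.2.1)
  have h3 := hax _ h2 (0, 0, 1) (by rw [hU]; simp) (t.2.2 - t₀.2.2)
  convert h3 using 1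
  ext <;> simp

/-- **Uniqueness of lifts**: two `Φ`-compatible step-preserving self-maps of `ℤ³` that agree at
one index agree everywhere (star-injectivity of `Φ`). [folklore] -/
theorem deck_unique {α : Type*} {Φ : ℤ × ℤ × ℤ → α} {adj : ℤ × ℤ × ℤ → ℤ × ℤ × ℤ → Prop}
    (hinj : ∀ r u₁ u₂, adj r u₁ → adj r u₂ → Φ u₁ = Φ u₂ → u₁ = u₂)
    {ρ₁ ρ₂ : ℤ × ℤ × ℤ → ℤ × ℤ × ℤ} (hΦ₁ : ∀ t, Φ (ρ₁ t) = Φ t) (hΦ₂ : ∀ t, Φ (ρ₂ t) = Φ t)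
    (hst₁ : ∀ t, ∀ v ∈ U, adj (ρ₁ t) (ρ₁ (t + v)))
    (hst₂ : ∀ t, ∀ v ∈ U, adj (ρ₂ t) (ρ₂ (t + v))) {t₀ : ℤ × ℤ × ℤ} (h₀ : ρ₁ t₀ = ρ₂ t₀) :
    ρ₁ = ρ₂ := by
  funext t
  refine deck_induction hU (C := fun t => ρ₁ t = ρ₂ t) t₀ h₀ ?_ t
  intro t v hv ht
  exact hinj (ρ₁ t) _ _ (hst₁ t v hv) (ht ▸ hst₂ t v hv) (by rw [hΦ₁, hΦ₂])

/-- **States by commuting permutations**: three pairwise commuting invertible moves on the good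
part of `P` integrate to a `ℤ³`-family of states `st` with `st (t + v) = lift v (st t)` for all six
unit steps (`st t = V̂^{k} Ĵ^{j} Î^{i} c₀` in `Equiv.Perm`). [folklore] -/
theorem deck_exists_state {P : Type*} (good : P → Prop) (lift : ℤ × ℤ × ℤ → P → P)
    (hgood : ∀ v ∈ U, ∀ c, good c → good (lift v c))
    (hinv : ∀ v ∈ U, ∀ c, good c → lift (-v) (lift v c) = c)
    (h12 : ∀ c, good c → lift (1, 0, 0) (lift (0, 1, 0) c) = lift (0, 1, 0) (lift (1, 0, 0) c))
    (h13 : ∀ c, good c → lift (1, 0, 0) (lift (0, 0, 1) c) = lift (0, 0, 1) (lift (1, 0, 0) c))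
    (h23 : ∀ c, good c → lift (0, 1, 0) (lift (0, 0, 1) c) = lift (0, 0, 1) (lift (0, 1, 0) c))
    {c₀ : P} (h₀ : good c₀) (t₀ : ℤ × ℤ × ℤ) :
    ∃ st : ℤ × ℤ × ℤ → P, st t₀ = c₀ ∧ (∀ t, good (st t)) ∧
      ∀ t, ∀ v ∈ U, st (t + v) = lift v (st t) := by
  -- the three moves as permutations of the good part
  let F : ∀ v, v ∈ U → Equiv.Perm {c // good c} := fun v hv =>
    { toFun := fun c => ⟨lift v c.1, hgood v hv c.1 c.2⟩
      invFun := fun c => ⟨lift (-v) c.1, hgood (-v) (deck_neg_mem hU hv) c.1 c.2⟩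
      left_inv := fun c => Subtype.ext (hinv v hv c.1 c.2)
      right_inv := fun c => Subtype.ext (by simpa using hinv (-v) (deck_neg_mem hU hv) c.1 c.2) }
  let F1 := F (1, 0, 0) (by rw [hU]; simp)
  let F2 := F (0, 1, 0) (by rw [hU]; simp)
  let F3 := F (0, 0, 1) (by rw [hU]; simp)
  have hF1 : ∀ c, (F1 c).1 = lift (1, 0, 0) c.1 := fun _ => rfl
  have hF2 : ∀ c, (F2 c).1 = lift (0, 1, 0) c.1 := fun _ => rfl
  have hF3 : ∀ c, (F3 c).1 = lift (0, 0, 1) c.1 := fun _ => rfl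
  have hF1' : ∀ c, (F1⁻¹ c).1 = lift (-1, 0, 0) c.1 := fun c =>
    (show (F1⁻¹ c).1 = lift (-(1, 0, 0)) c.1 from rfl).trans (by norm_num)
  have hF2' : ∀ c, (F2⁻¹ c).1 = lift (0, -1, 0) c.1 := fun c =>
    (show (F2⁻¹ c).1 = lift (-(0, 1, 0)) c.1 from rfl).trans (by norm_num)
  have hF3' : ∀ c, (F3⁻¹ c).1 = lift (0, 0, -1) c.1 := fun c =>
    (show (F3⁻¹ c).1 = lift (-(0, 0, 1)) c.1 from rfl).trans (by norm_num)
  have c12 : Commute F1 F2 := Equiv.ext fun c => Subtype.ext (h12 c.1 c.2)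
  have c13 : Commute F1 F3 := Equiv.ext fun c => Subtype.ext (h13 c.1 c.2)
  have c23 : Commute F2 F3 := Equiv.ext fun c => Subtype.ext (h23 c.1 c.2)
  let L : ℤ × ℤ × ℤ → Equiv.Perm {c // good c} := fun w => F1 ^ w.1 * F2 ^ w.2.1 * F3 ^ w.2.2
  have hL : ∀ w, L w = F1 ^ w.1 * F2 ^ w.2.1 * F3 ^ w.2.2 := fun _ => rfl
  refine ⟨fun t => (L (t - t₀) ⟨c₀, h₀⟩).1, by simp [hL], fun t => (L (t - t₀) ⟨c₀, h₀⟩).2, ?_⟩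
  intro t v hv
  -- `L (w + v) = G * L w` with `G` the permutation of the step `v`
  suffices key : ∃ G : Equiv.Perm {c // good c}, (∀ c, (G c).1 = lift v c.1) ∧
      L (t - t₀ + v) = G * L (t - t₀) by
    obtain ⟨G, hG, hGL⟩ := key
    simp only
    rw [add_sub_right_comm, hGL, Equiv.Perm.mul_apply, hG]
  generalize t - t₀ = w
  obtain ⟨a, b, c⟩ := w
  rw [hU] at hv
  simp only [Finset.mem_insert, Finset.mem_singleton] at hv
  rcases hv with rfl | rfl | rfl | rfl | rfl | rfl <;>
    simp only [hL, Prod.mk_add_mk, add_zero]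
  · refine ⟨F1, hF1, ?_⟩
    rw [← mul_self_zpow, mul_assoc F1, mul_assoc F1]
  · refine ⟨F1⁻¹, hF1', ?_⟩
    rw [add_comm a, zpow_add, zpow_neg_one, mul_assoc F1⁻¹, mul_assoc F1⁻¹]
  · refine ⟨F2, hF2, ?_⟩
    rw [← mul_self_zpow, ← mul_assoc (F1 ^ a) F2, (c12.zpow_left a).eq, mul_assoc F2,
      mul_assoc F2]
  · refine ⟨F2⁻¹, hF2', ?_⟩
    rw [add_comm b, zpow_add, zpow_neg_one, ← mul_assoc (F1 ^ a) F2⁻¹,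
      (c12.zpow_left a).inv_right.eq, mul_assoc F2⁻¹, mul_assoc F2⁻¹]
  · refine ⟨F3, hF3, ?_⟩
    rw [← mul_self_zpow, ← mul_assoc (F1 ^ a * F2 ^ b) F3,
      ((c13.zpow_left a).mul_left (c23.zpow_left b)).eq, mul_assoc F3]
  · refine ⟨F3⁻¹, hF3', ?_⟩
    rw [add_comm c, zpow_add, zpow_neg_one, ← mul_assoc (F1 ^ a * F2 ^ b) F3⁻¹,
      ((c13.zpow_left a).mul_left (c23.zpow_left b)).inv_right.eq, mul_assoc F3⁻¹]

/-- **Lift maps exist**: for a star-bijective, link-faithful `Φ` on the contact structure `adj`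
of `ℤ³` (unit steps are contacts, commuting unit squares have a contact diagonal, every contact
is a word of length `≤ 2` in the unit steps), any two indices over the same point are joined by
a `Φ`-compatible contact-preserving self-map. [folklore] -/
theorem deck_exists_map {α : Type*} {Φ : ℤ × ℤ × ℤ → α} {adj : ℤ × ℤ × ℤ → ℤ × ℤ × ℤ → Prop}
    (hsymm : ∀ t u, adj t u → adj u t)
    (hinj : ∀ r u₁ u₂, adj r u₁ → adj r u₂ → Φ u₁ = Φ u₂ → u₁ = u₂)
    (hsurj : ∀ r r' u, Φ r = Φ r' → adj r u → ∃ u', adj r' u' ∧ Φ u' = Φ u)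
    (hlink : ∀ r r' u₁ u₂ u₁' u₂', adj r u₁ → adj r u₂ → adj r' u₁' → adj r' u₂' →
      Φ u₁' = Φ u₁ → Φ u₂' = Φ u₂ → adj u₁ u₂ → adj u₁' u₂')
    (hunit : ∀ t, ∀ v ∈ U, adj t (t + v))
    (h12 : ∀ t : ℤ × ℤ × ℤ, adj t (t + (1, 0, 0) + (0, 1, 0)) ∨ adj (t + (0, 1, 0)) (t + (1, 0, 0)))
    (h13 : ∀ t : ℤ × ℤ × ℤ, adj t (t + (1, 0, 0) + (0, 0, 1)) ∨ adj (t + (0, 0, 1)) (t + (1, 0, 0)))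
    (h23 : ∀ t : ℤ × ℤ × ℤ, adj t (t + (0, 1, 0) + (0, 0, 1)) ∨ adj (t + (0, 0, 1)) (t + (0, 1, 0)))
    (hgen : ∀ t u, adj t u → (∃ v ∈ U, u = t + v) ∨ ∃ v ∈ U, ∃ w ∈ U, u = t + v + w)
    {t₀ t₀' : ℤ × ℤ × ℤ} (h₀ : Φ t₀ = Φ t₀') :
    ∃ ρ : ℤ × ℤ × ℤ → ℤ × ℤ × ℤ, (∀ t, Φ (ρ t) = Φ t) ∧ ρ t₀ = t₀' ∧
      ∀ t u, adj t u → adj (ρ t) (ρ u) := by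
  -- (P) the lifted unit steps on pairs `(index, sheet)` over the same point
  obtain ⟨lift, hlift⟩ : ∃ lift : ℤ × ℤ × ℤ → (ℤ × ℤ × ℤ) × (ℤ × ℤ × ℤ) → (ℤ × ℤ × ℤ) × (ℤ × ℤ × ℤ),
      ∀ v ∈ U, ∀ c, Φ c.1 = Φ c.2 →
        (lift v c).1 = c.1 + v ∧ adj c.2 (lift v c).2 ∧ Φ (lift v c).2 = Φ (c.1 + v) := by
    classical
    refine ⟨fun v c => if h : ∃ u, adj c.2 u ∧ Φ u = Φ (c.1 + v) then (c.1 + v, h.choose) else c,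
      fun v hv c hc => ?_⟩
    have h : ∃ u, adj c.2 u ∧ Φ u = Φ (c.1 + v) := hsurj c.1 c.2 (c.1 + v) hc (hunit c.1 v hv)
    simp only [dif_pos h, true_and]
    exact h.choose_spec
  have hgood : ∀ v ∈ U, ∀ c : (ℤ × ℤ × ℤ) × (ℤ × ℤ × ℤ), Φ c.1 = Φ c.2 →
      Φ (lift v c).1 = Φ (lift v c).2 := by
    intro v hv c hc
    obtain ⟨h1, -, h3⟩ := hlift v hv c hc
    rw [h1, h3]
  -- (C1) opposite steps have mutually inverse lifts
  have hinv : ∀ v ∈ U, ∀ c : (ℤ × ℤ × ℤ) × (ℤ × ℤ × ℤ), Φ c.1 = Φ c.2 →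
      lift (-v) (lift v c) = c := by
    intro v hv c hc
    obtain ⟨h1, h2, -⟩ := hlift v hv c hc
    obtain ⟨h1', h2', h3'⟩ := hlift (-v) (deck_neg_mem hU hv) (lift v c) (hgood v hv c hc)
    refine Prod.ext (by rw [h1', h1, add_neg_cancel_right]) (hinj _ _ _ h2' (hsymm _ _ h2) ?_)
    rw [h3', h1, add_neg_cancel_right, hc]
  -- (C2) commuting steps with a contact diagonal have commuting lifts
  have hcomm : ∀ v ∈ U, ∀ w ∈ U, (∀ t, adj t (t + v + w) ∨ adj (t + w) (t + v)) →
      ∀ c : (ℤ × ℤ × ℤ) × (ℤ × ℤ × ℤ), Φ c.1 = Φ c.2 → lift v (lift w c) = lift w (lift v c) := by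
    intro v hv w hw hdiag c hc
    obtain ⟨hw1, hw2, hw3⟩ := hlift w hw c hc
    obtain ⟨hv1, hv2, hv3⟩ := hlift v hv c hc
    obtain ⟨hb1, hb2, hb3⟩ := hlift v hv (lift w c) (hgood w hw c hc)
    obtain ⟨hd1, hd2, hd3⟩ := hlift w hw (lift v c) (hgood v hv c hc)
    rw [hw1] at hb1 hb3
    rw [hv1] at hd1 hd3
    rw [add_right_comm] at hd3
    refine Prod.ext (by rw [hb1, hd1, add_right_comm]) ?_
    refine deck_comm_pt hinj hsurj hlink (x := c.1 + w) (y := c.1 + v) (z := c.1 + w + v) hc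
      (hunit _ w hw) (hunit _ v hv) (hunit _ v hv) ?_ ?_ hw2 hw3 hb2 hb3 hv2 hv3 hd2 hd3
    · have := hunit (c.1 + v) w hw
      rwa [add_right_comm] at this
    · rcases hdiag c.1 with h | h
      · left
        rwa [add_right_comm] at h
      · exact Or.inr h
  -- (D) integrate the three basic lifted steps into states `st t = (t, sheet of t)`
  obtain ⟨st, hst₀, hstg, hstep⟩ := deck_exists_state hU
    (fun c : (ℤ × ℤ × ℤ) × (ℤ × ℤ × ℤ) => Φ c.1 = Φ c.2) lift hgood hinv
    (hcomm _ (by rw [hU]; simp) _ (by rw [hU]; simp) h12)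
    (hcomm _ (by rw [hU]; simp) _ (by rw [hU]; simp) h13)
    (hcomm _ (by rw [hU]; simp) _ (by rw [hU]; simp) h23) (c₀ := (t₀, t₀')) h₀ t₀
  have hfst : ∀ t, (st t).1 = t := deck_induction hU (C := fun t => (st t).1 = t) t₀ (by rw [hst₀])
    (fun t v hv ht => by rw [hstep t v hv, (hlift v hv _ (hstg t)).1, ht])
  have hΦ : ∀ t, Φ (st t).2 = Φ t := fun t => by rw [← hstg t, hfst t]
  have hadj₁ : ∀ t, ∀ v ∈ U, adj (st t).2 (st (t + v)).2 := fun t v hv => by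
    rw [hstep t v hv]
    exact (hlift v hv _ (hstg t)).2.1
  -- (C3) two-step contacts (contact triangles) are preserved
  have hadj₂ : ∀ t, ∀ v ∈ U, ∀ w ∈ U, adj t (t + v + w) →
      adj (st t).2 (st (t + v + w)).2 := fun t v hv w hw h =>
    deck_triangle_pt hinj hsurj hlink (hΦ t).symm (hunit t v hv) h (hunit _ w hw) (hadj₁ t v hv)
      (hΦ _) (hadj₁ _ w hw) (hΦ _)
  refine ⟨fun t => (st t).2, hΦ, by simp only [hst₀], fun t u h => ?_⟩
  rcases hgen t u h with ⟨v, hv, rfl⟩ | ⟨v, hv, w, hw, rfl⟩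
  · exact hadj₁ t v hv
  · exact hadj₂ t v hv w hw h

/-- **Deck transformations of `ℤ³`-indexed coverings**: under the hypotheses of
`deck_exists_map`, two distinct indices over the same point are exchanged by a FIXED-POINT-FREE
`Φ`-compatible bijection of `ℤ³` preserving and reflecting contacts. [folklore] -/
theorem deck_exists {α : Type*} {Φ : ℤ × ℤ × ℤ → α} {adj : ℤ × ℤ × ℤ → ℤ × ℤ × ℤ → Prop}
    (hsymm : ∀ t u, adj t u → adj u t)
    (hinj : ∀ r u₁ u₂, adj r u₁ → adj r u₂ → Φ u₁ = Φ u₂ → u₁ = u₂)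
    (hsurj : ∀ r r' u, Φ r = Φ r' → adj r u → ∃ u', adj r' u' ∧ Φ u' = Φ u)
    (hlink : ∀ r r' u₁ u₂ u₁' u₂', adj r u₁ → adj r u₂ → adj r' u₁' → adj r' u₂' →
      Φ u₁' = Φ u₁ → Φ u₂' = Φ u₂ → adj u₁ u₂ → adj u₁' u₂')
    (hunit : ∀ t, ∀ v ∈ U, adj t (t + v))
    (h12 : ∀ t : ℤ × ℤ × ℤ, adj t (t + (1, 0, 0) + (0, 1, 0)) ∨ adj (t + (0, 1, 0)) (t + (1, 0, 0)))
    (h13 : ∀ t : ℤ × ℤ × ℤ, adj t (t + (1, 0, 0) + (0, 0, 1)) ∨ adj (t + (0, 0, 1)) (t + (1, 0, 0)))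
    (h23 : ∀ t : ℤ × ℤ × ℤ, adj t (t + (0, 1, 0) + (0, 0, 1)) ∨ adj (t + (0, 0, 1)) (t + (0, 1, 0)))
    (hgen : ∀ t u, adj t u → (∃ v ∈ U, u = t + v) ∨ ∃ v ∈ U, ∃ w ∈ U, u = t + v + w)
    {t₀ t₀' : ℤ × ℤ × ℤ} (h₀ : Φ t₀ = Φ t₀') (hne : t₀ ≠ t₀') :
    ∃ ρ : ℤ × ℤ × ℤ → ℤ × ℤ × ℤ, Function.Bijective ρ ∧ (∀ t u, adj (ρ t) (ρ u) ↔ adj t u) ∧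
      (∀ t, Φ (ρ t) = Φ t) ∧ ρ t₀ = t₀' ∧ ∀ t, ρ t ≠ t := by
  obtain ⟨ρ, hΦρ, hρ₀, hρ⟩ := deck_exists_map hU hsymm hinj hsurj hlink hunit h12 h13 h23 hgen h₀
  obtain ⟨ρ', hΦρ', hρ'₀, hρ'⟩ :=
    deck_exists_map hU hsymm hinj hsurj hlink hunit h12 h13 h23 hgen h₀.symm
  have hst : ∀ t, ∀ v ∈ U, adj (ρ t) (ρ (t + v)) := fun t v hv => hρ _ _ (hunit t v hv)
  have hst' : ∀ t, ∀ v ∈ U, adj (ρ' t) (ρ' (t + v)) := fun t v hv => hρ' _ _ (hunit t v hv)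
  -- `ρ' ∘ ρ`, `ρ ∘ ρ'` and `id` are lifts agreeing at one index
  have h1 : ρ' ∘ ρ = id :=
    deck_unique hU hinj (ρ₁ := ρ' ∘ ρ) (ρ₂ := id) (fun t => (hΦρ' _).trans (hΦρ t)) (fun _ => rfl)
      (fun t v hv => hρ' _ _ (hst t v hv)) hunit (t₀ := t₀) (by simp [hρ₀, hρ'₀])
  have h2 : ρ ∘ ρ' = id :=
    deck_unique hU hinj (ρ₁ := ρ ∘ ρ') (ρ₂ := id) (fun t => (hΦρ _).trans (hΦρ' t)) (fun _ => rfl)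
      (fun t v hv => hρ _ _ (hst' t v hv)) hunit (t₀ := t₀') (by simp [hρ₀, hρ'₀])
  have hl : Function.LeftInverse ρ' ρ := fun t => congrFun h1 t
  have hr : Function.RightInverse ρ' ρ := fun t => congrFun h2 t
  refine ⟨ρ, ⟨hl.injective, hr.surjective⟩, fun t u => ⟨fun h => ?_, hρ t u⟩, hΦρ, hρ₀,
    fun t ht => hne ?_⟩
  · have := hρ' _ _ h
    rwa [hl t, hl u] at this
  · have := deck_unique hU hinj (ρ₁ := ρ) (ρ₂ := id) hΦρ (fun _ => rfl) hst hunit (t₀ := t) ht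
    rw [← hρ₀, this, id]

end Steps

end Summit.AtomisticToContinuum.Crystallization.Theorems.PalmUnimodularRigidityShellsToBarlowChart
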